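import Literature.Barriers.CriticalPhenomena.PlaquetteWalkHoleRootHoleColumn
import Literature.Barriers.CriticalPhenomena.PlaquetteWalkHoleRootThinSide
import HarnessLib

/-!
# Barrier catalogue (SAWScalingLimit): THE PREFIX WALL — an under-walk's excursion never takes the door between the
cells below the hole and below the root plaquette; with the column below the hole shut the under route is EMPTY;
LAW L's last residual cell, all boxes

Leaf of `PlaquetteWalkHoleRootHoleColumn` (the even–odd half: with the column below the hole shut, a WOUND walk's
excursion takes the door `holeS | rootS`) and `PlaquetteWalkHoleRootThinSide` (over blocks, route positivity), using the
prefix-loop machinery of `PlaquetteWalkHoleRootPrefixLoop` (the prefix of an under-walk, closed through the far cell and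
the hole, is a closed polygon `C` missed by the excursion polygon `J`; the winding number of `C` is constant along `J`
and jumps by one across the root edge). §1 ★★★★ THE PREFIX-WALL SEPARATION LEMMA
`ΩG.not_excursion_cross_rootS_W_of_under`: hole absent; for a class-`B2a` UNDER-walk at the far cell (first side `S`)
NO slot of the excursion polygon exits through the `W` side of `rootS = (w.1, w.2 − 1)` (the door to
`holeS = (w.1 − 1, w.2 − 1)`). Proof: if slot `j` did, the prefix does not use that mid-edge (a mid-edge is visited
once), so the upper half of that closed side joins its midpoint — a point of `J` — to the LOWER corner of the root edge
off `C`; the midpoint of the far cell's top side — also on `J` — is joined to the UPPER corner along the top sides of the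
far cell and of the hole, off `C` (as in `exists_prefix_nth_eq_root_S`); so the two corners would have the same winding
number — against the jump. §2 with `PlaquetteWalkHoleRootHoleColumn`: ★★★★★ `ΩG.WE_eq_excursionWinding_of_under_holeColumn`
— hole absent and the column below the hole shut (`(w.1 − 1, y) ∉ D` for `y ≤ w.2 − 2`) ⇒ NO under-walk is wound; the
under route mass vanishes; row mirror for the column above the hole. §3 `Im VF(θ) > 0` on `[π/3, 2π/3]` with the two
over blocks, `VF ≠ 0`; mirror. §4 ALL BOXES with the hole two rows above the bottom wall (`h.2 = 2`): removing the bottom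
cell `(h.1, 0)` directly below the hole alone ⇒ ★★★★★ `lawL_box_holeSS_vertexFunctional_ne_zero` (no zero on the whole
range) and `lawL_box_holeSS_not_wound_under` — LAW L's LAST residual cell (the lane's kit datum j283492: no free wound
under-walk ≤ 44 arcs in `7×5 ∖ {hole, (3,0)}`); top mirror `lawL_box_holeNN_im_neg`.

Not in print; venture lane «pcv-sawmu», seat b-step0 gen 26.

References: A. Glazman, I. Manolescu, arXiv:1708.00395v3, §1 (Fig. 1, Fig. 2), §2.1, §4.2 and Lemma 2.1
[GlazmanManolescu2019]; A. Glazman, Electron. Commun. Probab. 20 (2015) no. 86, Lemma 3.1, proof pp. 6–7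
[Glazman2015WeightedSAW]; R. Courant, H. Robbins, *What is Mathematics?* (1941/1958), Ch. V Appendix §2 (the even–odd
rule; the Jordan curve theorem for polygons) [CourantRobbins1958]; L. V. Ahlfors, *Complex Analysis* (1979), Ch. 4 §2.1
(index of a point with respect to a closed curve) [AhlforsCA1979].
-/

noncomputable section

open Set Function Complex

namespace Literature.Probability.RandomPlanarGeometry.SAW.YangBaxter

open Real
open Literature.Barriers.CriticalPhenomena.PlaquetteWalk (mirrorRowFace mirrorRowFace_mirrorRowFace)

open private len_eq side_jOut segment_pJ_even toC_midPt_side_mem_sideSeg sideSeg_coords_W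
  from Literature.Probability.RandomPlanarGeometry.YangBaxterSAWExcursionJordan
open private fSeg_coords hSeg_coords not_mem_sideSeg_N_of_mem_fSeg_hSeg toC_midPt_mem_crossSeg
  from Literature.Barriers.CriticalPhenomena.PlaquetteWalkHoleRootPrefixLoop

namespace ΩG

/-! ## §1 The prefix-wall separation lemma -/

section Geometry

variable (w : Face)

/-- The two segments through the far cell and the hole miss the closed `W` side of the cell below the root plaquette
(they lie west of its line, resp. above it). [folklore] [cite: CourantRobbins1958, Ch. V Appendix §2 (the even–odd rule)] -/
theorem not_mem_sideSeg_rootS_W_of_mem_fSeg_hSeg {q : ℂ} (hq : q ∈ fSeg w ∨ q ∈ hSeg w) :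
    q ∉ sideSeg (rootS w) .W := by
  intro hq'
  obtain ⟨hx, -, hy⟩ := sideSeg_coords_W hq'
  simp only [rootS, Int.cast_sub, Int.cast_one] at hx hy
  rcases hq with hq | hq
  · obtain ⟨t, -, ht1, hx', -⟩ := fSeg_coords w hq
    rw [hx'] at hx; linarith
  · obtain ⟨hy', -, -⟩ := hSeg_coords w hq
    rw [hy'] at hy; linarith

/-- The lower corner of the root edge is the upper corner of the `W` side of the cell below the root plaquette.
[cite: GlazmanManolescu2019, §1 (the lattice of rhombi and its mid-edges)] -/
theorem cLo_eq_rootS_W_endB : cLo w = toC ((rootS w).base + Side.W.endB) := by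
  rw [cLo]
  congr 1
  obtain ⟨a, b⟩ := w
  simp [rootS, Face.base, Side.endA, Side.endB]
  ring

/-- The upper half of that side: from the corner down to the midpoint of the door `holeS | rootS`.
[cite: CourantRobbins1958, Ch. V Appendix §2 (the even–odd rule)] -/
theorem segment_cLo_midPt_subset_sideSeg_rootS_W :
    segment ℝ (cLo w) (toC (midPt ((rootS w).side .W))) ⊆ sideSeg (rootS w) .W :=
  (convex_segment _ _).segment_subset (by rw [cLo_eq_rootS_W_endB]; exact right_mem_segment _ _ _)
    (toC_midPt_side_mem_sideSeg _ _)

end Geometry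

variable {D : Set Face} {w : Face}

/-- ★★★★ **THE PREFIX-WALL SEPARATION LEMMA: an under-walk's excursion never takes the door `holeS | rootS`.** Hole
absent; `ω` a class-`B2a` walk at the far cell first reaching it from `S`. Then no slot of its excursion polygon exits
through the `W` side of `rootS = (w.1, w.2 − 1)`. For if slot `j` did: the prefix loop `C` (prefix + far-cell segment +
hole segment) has one winding number along the excursion polygon `J` (`windC_pJ_edge`), which passes through the
midpoint of the far cell's top side and through the midpoint of that `W` side; the first is joined to the upper corner
of the root edge along the top sides of the hole and of the far cell, the second to the lower corner along the upper
half of that `W` side — both off `C` (the prefix neither enters the hole nor touches the far cell before the first hit,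
and it does not use a mid-edge the excursion uses) — so the two corners of the root edge would have equal winding
numbers, contradicting `windC_jump`. [cite: CourantRobbins1958, Ch. V Appendix §2 (The Jordan Curve Theorem for Polygons)]
[cite: AhlforsCA1979, Ch. 4 §2.1 (index of a point with respect to a closed curve)]
[cite: Glazman2015WeightedSAW, Lemma 3.1 (proof, pp. 6–7: the classes of walks through a rhombus)] -/
theorem not_excursion_cross_rootS_W_of_under (hh : holeFaceW w ∉ D) (ω : ΩG D (w.side .W) (farW w))
    (hr : RootedFace D (w.side .W) (farW w)) (h : ω.IsB2a) (hS : ω.2.firstSideG = .S) :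
    ¬∃ j, j < ω.Mv ∧ (ω.jFace h j).side (ω.jOut hr h j) = (rootS w).side .W := by
  rintro ⟨j, hj, hje⟩
  have hM := ω.three_le_Mv hr h
  have hF := ω.fh_lt h
  have h1 := ω.one_le_firstHitG_far
  have hlen : ω.2.arcs.length = ω.2.firstHitG + ω.Mv := len_eq h
  set F := ω.2.firstHitG with hFdef
  set n := ω.2.arcs.length with hndef
  have hnthF : ω.2.nth F = (farW w).side .S := by rw [hFdef, ω.2.nth_firstHitG, hS]
  -- the prefix does not use the door (the excursion does, at index `F + j + 1`)
  have hP' : ∀ i, 1 ≤ i → i ≤ F → ω.2.nth i ≠ (rootS w).side .W := by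
    intro i hi1 hiF e
    rw [← hje, side_jOut (hr := hr) h hj] at e
    have := ω.2.nth_inj (by omega) (by omega) e
    omega
  -- the auxiliary points
  set q1 : ℂ := toC ((holeFaceW w).base + Side.N.endA) with hq1
  set mN : ℂ := toC (midPt ((farW w).side .N)) with hmN
  set mW : ℂ := toC (midPt ((rootS w).side .W)) with hmW
  -- P1: the top side of the hole
  have hP1 : segment ℝ (cHi w) q1 = sideSeg (holeFaceW w) .N := by
    rw [segment_symm, sideSeg, cHi]
    congr 2
    obtain ⟨a, b⟩ := w; simp [holeFaceW, Face.base, Side.endB]; ring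
  have w1 : ω.windC (cHi w) = ω.windC q1 := by
    refine windC_eq_of_segment fun z hz k hk hzk => ?_
    rw [hP1] at hz
    obtain ⟨i, hi1, hiF, e⟩ := exists_nth_eq_of_mem_pCedge_sideSeg hh h hS hk hzk hz
      (fun q hq => not_mem_sideSeg_N_of_mem_fSeg_hSeg (by simp [holeFaceW]) hq)
    have hd := ω.2.door_nth (j := i) (by omega) (by omega)
    rw [e] at hd
    have : ((holeFaceW w).side .N).faces.1 = holeFaceW w := by
      obtain ⟨a, b⟩ := w; simp [holeFaceW, Face.side, MidEdge.faces]
    rw [this] at hd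
    exact hh hd.1
  -- P2: the right half of the top side of the far cell
  have hP2 : segment ℝ q1 mN ⊆ sideSeg (farW w) .N := by
    refine (convex_segment _ _).segment_subset ?_ (toC_midPt_side_mem_sideSeg _ _)
    have e : q1 = toC ((farW w).base + Side.N.endB) := by
      rw [hq1]; congr 1; obtain ⟨a, b⟩ := w; simp [holeFaceW, farW, Face.base, Side.endA, Side.endB]; ring
    rw [e]; exact right_mem_segment _ _ _
  have w2 : ω.windC q1 = ω.windC mN := by
    refine windC_eq_of_segment fun z hz k hk hzk => ?_
    obtain ⟨i, hi1, hiF, e⟩ := exists_nth_eq_of_mem_pCedge_sideSeg hh h hS hk hzk (hP2 hz)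
      (fun q hq => not_mem_sideSeg_N_of_mem_fSeg_hSeg (by simp [farW]) hq)
    have hle := firstHitG_le_of_nth_eq (ω := ω) (by omega) e
    have ei : i = F := by omega
    rw [ei, hnthF] at e
    exact absurd (Face.side_injective (farW w) e) (by decide)
  -- P3: the upper half of the `W` side of the cell below the root plaquette
  have w3 : ω.windC (cLo w) = ω.windC mW := by
    refine windC_eq_of_segment fun z hz k hk hzk => ?_
    obtain ⟨i, hi1, hiF, e⟩ := exists_nth_eq_of_mem_pCedge_sideSeg hh h hS hk hzk
      (segment_cLo_midPt_subset_sideSeg_rootS_W w hz) (fun q hq => not_mem_sideSeg_rootS_W_of_mem_fSeg_hSeg w hq)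
    exact hP' i hi1 hiF e
  -- the two midpoints lie on `J`
  obtain ⟨j₀, hj₀, hj₀e⟩ := exists_jOut_eq_farW_N hh hr h hS
  have wN : ω.windC mN = ω.windC (ω.pJ hr h 0) := by
    refine windC_pJ_edge hh hr h hS (k := 2 * j₀) (by omega) ?_
    rw [segment_pJ_even h hj₀, hj₀e]
    exact toC_midPt_mem_crossSeg _
  have wW : ω.windC mW = ω.windC (ω.pJ hr h 0) := by
    refine windC_pJ_edge hh hr h hS (k := 2 * j) (by omega) ?_
    rw [segment_pJ_even h hj, hje]
    exact toC_midPt_mem_crossSeg _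
  have := windC_jump hh h hS
  rw [w1, w2, wN, ← wW, ← w3, sub_self] at this
  exact zero_ne_one this

/-! ## §2 The column below the hole shut: the under route is empty -/

/-- ★★★★★ **THE COLUMN BELOW THE HOLE SHUT EMPTIES THE UNDER ROUTE.** Hole absent and `(w.1 − 1, y) ∉ D` for every
`y ≤ w.2 − 2`: a wound under-walk's excursion would take the door `holeS | rootS` (the even–odd half,
`exists_excursion_nth_eq_rootS_W_of_wound_holeColumn`) — which §1 forbids. So NO class-`B2a` under-walk at the far cell
is wound. [cite: GlazmanManolescu2019, Lemma 2.1 (statement, "in the form given in [Gl]"), §1 (Fig. 2)]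
[cite: Glazman2015WeightedSAW, Lemma 3.1 (proof, pp. 6–7)] [cite: CourantRobbins1958, Ch. V Appendix §2 (the even–odd rule; the Jordan curve theorem for polygons)] -/
theorem WE_eq_excursionWinding_of_under_holeColumn (hh : holeFaceW w ∉ D)
    (hcol : ∀ y : ℤ, y ≤ w.2 - 2 → ((w.1 - 1, y) : Face) ∉ D)
    (ω : ΩG D (w.side .W) (farW w)) (hr : RootedFace D (w.side .W) (farW w)) (h : ω.IsB2a)
    (hS : ω.2.firstSideG = .S) (θ : ℝ) :
    ω.WE (fun _ => θ) = excursionWinding θ ω.2.firstSideG (ω.z1 hr h) ω.1 := by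
  by_contra hW
  obtain ⟨k, hk1, hk2, e⟩ := exists_excursion_nth_eq_rootS_W_of_wound_holeColumn hcol ω hr h hW
  refine not_excursion_cross_rootS_W_of_under hh ω hr h hS ⟨k - ω.2.firstHitG - 1, by unfold ΩG.Mv; omega, ?_⟩
  rw [side_jOut (hr := hr) h (by unfold ΩG.Mv; omega),
    show ω.2.firstHitG + (k - ω.2.firstHitG - 1) + 1 = k by omega, e]

/-- ★★★ The under route mass vanishes identically once the column below the hole is shut.
[cite: GlazmanManolescu2019, Lemma 2.1 (statement, "in the form given in [Gl]")] -/
theorem sum_routeMassW_S_eq_zero_of_holeColumn [Finite D] (hh : holeFaceW w ∉ D)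
    (hcol : ∀ y : ℤ, y ≤ w.2 - 2 → ((w.1 - 1, y) : Face) ∉ D) (hr : RootedFace D (w.side .W) (farW w)) (θ : ℝ) :
    ∑ ω ∈ setB2a D (w.side .W) (farW w), routeMassW θ hr .S ω = 0 := by
  classical
  refine Finset.sum_eq_zero fun ω _ => ?_
  unfold routeMassW
  split_ifs with h1 h2
  · exact absurd (WE_eq_excursionWinding_of_under_holeColumn hh hcol ω hr h1 h2.1 θ) h2.2
  · rfl
  · rfl

/-! ## §2b Row mirror: the column above the hole shut empties the over route -/

/-- The reflection on a cell, in coordinates. [cite: GlazmanManolescu2019, §4.2 (lattice symmetries)] -/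
private theorem mirrorRowFace_mkPW (w : Face) (x y : ℤ) : mirrorRowFace w.2 ((x, y) : Face) = (x, 2 * w.2 - y) := by
  simp [mirrorRowFace]

/-- ★★★★★ **THE COLUMN ABOVE THE HOLE SHUT EMPTIES THE OVER ROUTE** (row mirror).
[cite: GlazmanManolescu2019, §1 (Fig. 1, Fig. 2), §4.2 (lattice symmetries), Lemma 2.1] [cite: Glazman2015WeightedSAW, Lemma 3.1 (proof, pp. 6–7)] -/
theorem WE_eq_excursionWinding_of_over_holeColumnN (hh : holeFaceW w ∉ D)
    (hcol : ∀ y : ℤ, w.2 + 2 ≤ y → ((w.1 - 1, y) : Face) ∉ D)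
    (ω : ΩG D (w.side .W) (farW w)) (hr : RootedFace D (w.side .W) (farW w)) (h : ω.IsB2a)
    (hN : ω.2.firstSideG = .N) (θ : ℝ) :
    ω.WE (fun _ => θ) = excursionWinding θ ω.2.firstSideG (ω.z1 hr h) ω.1 := by
  by_contra hW
  have hr' := rootedFace_rowMirrorDom w hr
  have h' := ω.mirrorFar_isB2a hr h
  have hh' : holeFaceW w ∉ rowMirrorDom w D := by rwa [mem_rowMirrorDom, mirrorRowFace_holeFaceW]
  have hcol' : ∀ y : ℤ, y ≤ w.2 - 2 → ((w.1 - 1, y) : Face) ∉ rowMirrorDom w D := by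
    intro y hy
    rw [mem_rowMirrorDom, mirrorRowFace_mkPW]
    exact hcol (2 * w.2 - y) (by omega)
  have hS' : ω.mirrorFar.2.firstSideG = .S := by rw [mirrorFar_firstSideG, hN]; rfl
  exact absurd (WE_eq_excursionWinding_of_under_holeColumn hh' hcol' ω.mirrorFar hr' h' hS' _)
    (ω.mirrorFar_wound hr h hW)

/-- ★★★ The over route mass vanishes identically once the column above the hole is shut.
[cite: GlazmanManolescu2019, Lemma 2.1 (statement, "in the form given in [Gl]")] -/
theorem sum_routeMassW_N_eq_zero_of_holeColumnN [Finite D] (hh : holeFaceW w ∉ D)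
    (hcol : ∀ y : ℤ, w.2 + 2 ≤ y → ((w.1 - 1, y) : Face) ∉ D) (hr : RootedFace D (w.side .W) (farW w)) (θ : ℝ) :
    ∑ ω ∈ setB2a D (w.side .W) (farW w), routeMassW θ hr .N ω = 0 := by
  classical
  refine Finset.sum_eq_zero fun ω _ => ?_
  unfold routeMassW
  split_ifs with h1 h2
  · exact absurd (WE_eq_excursionWinding_of_over_holeColumnN hh hcol ω hr h1 h2.1 θ) h2.2
  · rfl
  · rfl

end ΩG

end Literature.Probability.RandomPlanarGeometry.SAW.YangBaxter

namespace Literature.Barriers.CriticalPhenomena.PlaquetteWalk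

open Literature.Probability.RandomPlanarGeometry.SAW.YangBaxter
open Real Complex

/-! ## §3 The signs -/

section Signs

variable {Dl : List Face} {w : Face}

/-- ★★★★★ **COLUMN BELOW THE HOLE SHUT ⇒ `Im VF(θ) > 0` FOR EVERY `θ ∈ [π/3, 2π/3]`** (hole absent, the two over blocks
present): the under route is empty and the over route free and positive.
[cite: GlazmanManolescu2019, Lemma 2.1 (statement, "in the form given in [Gl]"), §1 eq. (1)]
[cite: Glazman2015WeightedSAW, Lemma 3.1 (proof, pp. 6–7)] [cite: CourantRobbins1958, Ch. V Appendix §2 (the Jordan curve theorem for polygons)] -/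
theorem im_vertexFunctional_printed_pos_of_holeColumn {θ : ℝ} (hθ : θ ∈ Set.Icc (π / 3) (2 * π / 3))
    (hBW : ∀ c ∈ overBlockW w, c ∈ Dl) (hBE : ∀ c ∈ overBlockE w, c ∈ Dl)
    (hf : farW w ∈ Dl) (hh : holeFaceW w ∉ dom Dl)
    (hcol : ∀ y : ℤ, y ≤ w.2 - 2 → ((w.1 - 1, y) : Face) ∉ dom Dl) :
    0 < (vertexFunctional (printedWeights θ) tFiveEighths (ybCoeff θ) Dl (w.side .W) (farW w)).im := by
  have hr : RootedFace (dom Dl) (w.side .W) (farW w) := ⟨hf, fun hb => hh (by rw [root_faces_W] at hb; exact hb.1)⟩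
  have hkill : ∀ (ω : ΩG (dom Dl) (w.side .W) (farW w)) (h : ω.IsB2a), ω.2.firstSideG = .S →
      ω.WE (fun _ => θ) ≠ excursionWinding θ ω.2.firstSideG (ω.z1 hr h) ω.1 → ¬ω.2.W2FreeOff (farW w) :=
    fun ω h hS hW => absurd (ΩG.WE_eq_excursionWinding_of_under_holeColumn hh hcol ω hr h hS θ) hW
  have hkill1 : ∀ (ω : ΩG (dom Dl) (w.side .W) (farW w)) (h : ω.IsB2a), ω.2.firstSideG = .S →
      ω.WE (fun _ => θ) ≠ excursionWinding θ ω.2.firstSideG (ω.z1 hr h) ω.1 → ¬ω.2.W1FreeOff (farW w) :=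
    fun ω h hS hW => absurd (ΩG.WE_eq_excursionWinding_of_under_holeColumn hh hcol ω hr h hS θ) hW
  rcases eq_or_lt_of_le hθ.1 with e1 | h1
  · subst e1
    exact im_vertexFunctional_printed_farCellW_pi_div_three_pos_of_under_killed Dl w hf hh hr hkill
      (exists_over_w2free_of_overBlockW hBW hr _)
  rcases eq_or_lt_of_le hθ.2 with e2 | h2
  · subst e2
    exact im_vertexFunctional_printed_farCellW_two_pi_div_three_pos_of_under_killed Dl w hf hh hr hkill1
      (exists_over_w1free_of_overBlockE hBE hr _)
  have hθo : θ ∈ Set.Ioo (π / 3) (2 * π / 3) := ⟨h1, h2⟩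
  rw [vertexFunctional_printed_farCellW_im_eq hθ Dl w hf hh hr,
    ΩG.sum_routeMassW_S_eq_zero_of_holeColumn hh hcol hr θ, sub_zero]
  obtain ⟨ω, h, hN, hW, -⟩ := exists_over_w2free_of_overBlockW hBW hr θ
  exact mul_pos (weightV_pos_of_mem_Ioo ⟨by linarith [hθo.1, Real.pi_pos], by linarith [hθo.2, Real.pi_pos]⟩)
    (ΩG.sum_routeMassW_pos_of_wound hr .N hθo ⟨ω, h, hN, hW⟩)

/-- ★★★★★ **COLUMN BELOW THE HOLE SHUT ⇒ NO ZERO OF THE FAR-CELL VERTEX FUNCTIONAL ON `[π/3, 2π/3]`.**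
[cite: GlazmanManolescu2019, Lemma 2.1 (statement, "in the form given in [Gl]")] [cite: Glazman2015WeightedSAW, Lemma 3.1 (proof, pp. 6–7)] -/
theorem vertexFunctional_printed_ne_zero_of_holeColumn {θ : ℝ} (hθ : θ ∈ Set.Icc (π / 3) (2 * π / 3))
    (hBW : ∀ c ∈ overBlockW w, c ∈ Dl) (hBE : ∀ c ∈ overBlockE w, c ∈ Dl)
    (hf : farW w ∈ Dl) (hh : holeFaceW w ∉ dom Dl)
    (hcol : ∀ y : ℤ, y ≤ w.2 - 2 → ((w.1 - 1, y) : Face) ∉ dom Dl) :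
    vertexFunctional (printedWeights θ) tFiveEighths (ybCoeff θ) Dl (w.side .W) (farW w) ≠ 0 := by
  intro e
  have hpos := im_vertexFunctional_printed_pos_of_holeColumn hθ hBW hBE hf hh hcol
  rw [e, Complex.zero_im] at hpos
  exact lt_irrefl _ hpos

/-- ★★★★★ **COLUMN ABOVE THE HOLE SHUT ⇒ `Im VF(θ) < 0` FOR EVERY `θ ∈ [π/3, 2π/3]`** (row mirror; both under blocks
present). [cite: GlazmanManolescu2019, Lemma 2.1 (statement, "in the form given in [Gl]"), §1 eq. (1)]
[cite: Glazman2015WeightedSAW, Lemma 3.1 (proof, pp. 6–7)] -/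
theorem im_vertexFunctional_printed_neg_of_holeColumnN {θ : ℝ} (hθ : θ ∈ Set.Icc (π / 3) (2 * π / 3))
    (hBW : ∀ c ∈ underBlockW w, c ∈ Dl) (hBE : ∀ c ∈ underBlockE w, c ∈ Dl)
    (hf : farW w ∈ Dl) (hh : holeFaceW w ∉ dom Dl)
    (hcol : ∀ y : ℤ, w.2 + 2 ≤ y → ((w.1 - 1, y) : Face) ∉ dom Dl) :
    (vertexFunctional (printedWeights θ) tFiveEighths (ybCoeff θ) Dl (w.side .W) (farW w)).im < 0 := by
  have hr : RootedFace (dom Dl) (w.side .W) (farW w) := ⟨hf, fun hb => hh (by rw [root_faces_W] at hb; exact hb.1)⟩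
  have hkill : ∀ (ω : ΩG (dom Dl) (w.side .W) (farW w)) (h : ω.IsB2a), ω.2.firstSideG = .N →
      ω.WE (fun _ => θ) ≠ excursionWinding θ ω.2.firstSideG (ω.z1 hr h) ω.1 → ¬ω.2.W1FreeOff (farW w) :=
    fun ω h hN hW => absurd (ΩG.WE_eq_excursionWinding_of_over_holeColumnN hh hcol ω hr h hN θ) hW
  have hkill2 : ∀ (ω : ΩG (dom Dl) (w.side .W) (farW w)) (h : ω.IsB2a), ω.2.firstSideG = .N →
      ω.WE (fun _ => θ) ≠ excursionWinding θ ω.2.firstSideG (ω.z1 hr h) ω.1 → ¬ω.2.W2FreeOff (farW w) :=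
    fun ω h hN hW => absurd (ΩG.WE_eq_excursionWinding_of_over_holeColumnN hh hcol ω hr h hN θ) hW
  rcases eq_or_lt_of_le hθ.1 with e1 | h1
  · subst e1
    exact im_vertexFunctional_printed_farCellW_pi_div_three_neg_of_over_killed Dl w hf hh hr hkill2
      (exists_under_w2free_of_underBlockE hBE hr _)
  rcases eq_or_lt_of_le hθ.2 with e2 | h2
  · subst e2
    exact im_vertexFunctional_printed_farCellW_two_pi_div_three_neg_of_over_killed Dl w hf hh hr hkill
      (exists_under_w1free_of_underBlockW hBW hr _)
  have hθo : θ ∈ Set.Ioo (π / 3) (2 * π / 3) := ⟨h1, h2⟩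
  rw [vertexFunctional_printed_farCellW_im_eq hθ Dl w hf hh hr,
    ΩG.sum_routeMassW_N_eq_zero_of_holeColumnN hh hcol hr θ, zero_sub, mul_neg, neg_lt_zero]
  obtain ⟨ω, h, hS, hW, -⟩ := exists_under_w1free_of_underBlockW hBW hr θ
  exact mul_pos (weightV_pos_of_mem_Ioo ⟨by linarith [hθo.1, Real.pi_pos], by linarith [hθo.2, Real.pi_pos]⟩)
    (ΩG.sum_routeMassW_pos_of_wound hr .S hθo ⟨ω, h, hS, hW⟩)

end Signs

/-! ## §4 LAW L's last residual cell, all boxes -/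

section Boxes

variable {m n : ℕ} {h : Face}

/-- The two over blocks fit in the box when the hole is two rows above the bottom wall and the bottom cell `(h.1, 0)`
below the hole is removed. [cite: GlazmanManolescu2019, §2.1 (finite domains of faces)] -/
theorem overBlocks_hroot_subset_boxMinus_holeSS (hW : 2 ≤ h.1) (hE : h.1 + 3 ≤ m) (hS : h.2 = 2) (hN : h.2 + 3 ≤ n) :
    (∀ c ∈ overBlockW (h.1 + 1, h.2), c ∈ boxMinus m n [h, (h.1, 0)]) ∧
      ∀ c ∈ overBlockE (h.1 + 1, h.2), c ∈ boxMinus m n [h, (h.1, 0)] := by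
  have bW : ∀ c ∈ overBlockW42, 1 ≤ c.1 ∧ c.1 ≤ 5 ∧ 1 ≤ c.2 ∧ c.2 ≤ 4 ∧ c ≠ (3, 2) := by decide
  have bE : ∀ c ∈ overBlockE42, 1 ≤ c.1 ∧ c.1 ≤ 5 ∧ 1 ≤ c.2 ∧ c.2 ≤ 4 ∧ c ≠ (3, 2) := by decide
  constructor
  · intro c hc
    simp only [overBlockW, List.mem_map] at hc
    obtain ⟨a, ha, rfl⟩ := hc
    obtain ⟨b1, b2, b3, b4, b5⟩ := bW a ha
    obtain ⟨x, y⟩ := a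
    simp only [ne_eq, Prod.mk.injEq, not_and] at b1 b2 b3 b4 b5
    rw [shiftBy_refShift_mk, mem_boxMinus]
    simp only [List.mem_cons, List.not_mem_nil, or_false, not_or]
    refine ⟨⟨by omega, by omega, by omega, by omega⟩, fun e => ?_, fun e => ?_⟩
    · have e' := Prod.ext_iff.1 e; simp only at e'; omega
    · have e' := Prod.ext_iff.1 e; simp only at e'; omega
  · intro c hc
    simp only [overBlockE, List.mem_map] at hc
    obtain ⟨a, ha, rfl⟩ := hc
    obtain ⟨b1, b2, b3, b4, b5⟩ := bE a ha
    obtain ⟨x, y⟩ := a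
    simp only [ne_eq, Prod.mk.injEq, not_and] at b1 b2 b3 b4 b5
    rw [shiftBy_refShift_mk, mem_boxMinus]
    simp only [List.mem_cons, List.not_mem_nil, or_false, not_or]
    refine ⟨⟨by omega, by omega, by omega, by omega⟩, fun e => ?_, fun e => ?_⟩
    · have e' := Prod.ext_iff.1 e; simp only at e'; omega
    · have e' := Prod.ext_iff.1 e; simp only at e'; omega

/-- ★★★★★ **LAW L's LAST RESIDUAL CELL `(h.1, 0)`, ALL BOXES: NO ZERO ON THE WHOLE RANGE.** In the `m × n` box with the
hole `h` two rows above the bottom wall (`h.2 = 2`, `2 ≤ h.1`, `h.1 + 3 ≤ m`, `h.2 + 3 ≤ n`), removing the bottom cell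
`(h.1, 0)` directly below the hole alone shuts the column below the hole: the under route is EMPTY and the over route
free, `VF(θ) ≠ 0` for every `θ ∈ [π/3, 2π/3]`. [cite: GlazmanManolescu2019, Lemma 2.1 (statement, "in the form given in [Gl]"), §2.1]
[cite: Glazman2015WeightedSAW, Lemma 3.1 (proof, pp. 6–7)] -/
theorem lawL_box_holeSS_vertexFunctional_ne_zero (hW : 2 ≤ h.1) (hE : h.1 + 3 ≤ m) (hS : h.2 = 2) (hN : h.2 + 3 ≤ n)
    {θ : ℝ} (hθ : θ ∈ Set.Icc (π / 3) (2 * π / 3)) :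
    vertexFunctional (printedWeights θ) tFiveEighths (ybCoeff θ) (boxMinus m n [h, (h.1, 0)])
      (Face.side (h.1 + 1, h.2) .W) (farW (h.1 + 1, h.2)) ≠ 0 := by
  obtain ⟨hBW, hBE⟩ := overBlocks_hroot_subset_boxMinus_holeSS hW hE hS hN
  refine vertexFunctional_printed_ne_zero_of_holeColumn hθ hBW hBE ?_ ?_ fun y hy => ?_
  · rw [mem_boxMinus]; simp only [farW, List.mem_cons, List.not_mem_nil, or_false, not_or]
    refine ⟨⟨by omega, by omega, by omega, by omega⟩, fun e => ?_, fun e => ?_⟩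
    · have e' := Prod.ext_iff.1 e; simp only at e'; omega
    · have e' := Prod.ext_iff.1 e; simp only at e'; omega
  · rw [holeFaceW_hroot]; exact not_mem_dom_boxMinus_of_mem (by simp)
  · intro hm
    have hb := mem_dom_boxMinus.1 hm
    simp only [List.mem_cons, List.not_mem_nil, or_false, not_or, Prod.mk.injEq] at hb hy
    omega

/-- ★★★★ In that box NO under-walk at the far cell is wound: the under route is EMPTY.
[cite: GlazmanManolescu2019, Lemma 2.1 (statement, "in the form given in [Gl]")] [cite: Glazman2015WeightedSAW, Lemma 3.1 (proof, pp. 6–7)] -/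
theorem lawL_box_holeSS_not_wound_under (hS : h.2 = 2)
    (hr : RootedFace (dom (boxMinus m n [h, (h.1, 0)])) (Face.side (h.1 + 1, h.2) .W) (farW (h.1 + 1, h.2)))
    (ω : ΩG (dom (boxMinus m n [h, (h.1, 0)])) (Face.side (h.1 + 1, h.2) .W) (farW (h.1 + 1, h.2)))
    (hω : ω.IsB2a) (hSd : ω.2.firstSideG = .S) (θ : ℝ) :
    ω.WE (fun _ => θ) = excursionWinding θ ω.2.firstSideG (ω.z1 hr hω) ω.1 := by
  refine ΩG.WE_eq_excursionWinding_of_under_holeColumn ?_ (fun y hy => ?_) ω hr hω hSd θ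
  · rw [holeFaceW_hroot]; exact not_mem_dom_boxMinus_of_mem (by simp)
  · intro hm
    have hb := mem_dom_boxMinus.1 hm
    simp only [List.mem_cons, List.not_mem_nil, or_false, not_or, Prod.mk.injEq] at hb hy
    omega

/-- The two under blocks fit in the box when the top cell `(h.1, n − 1)` above the hole is removed (hole two rows below
the top wall). [cite: GlazmanManolescu2019, §2.1 (finite domains of faces)] -/
theorem underBlocks_hroot_subset_boxMinus_holeNN (hW : 2 ≤ h.1) (hE : h.1 + 3 ≤ m) (hS : 2 ≤ h.2)
    (hN : h.2 + 3 = n) :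
    (∀ c ∈ underBlockW (h.1 + 1, h.2), c ∈ boxMinus m n [h, (h.1, h.2 + 2)]) ∧
      ∀ c ∈ underBlockE (h.1 + 1, h.2), c ∈ boxMinus m n [h, (h.1, h.2 + 2)] := by
  have bW : ∀ c ∈ underBlockW42, 1 ≤ c.1 ∧ c.1 ≤ 5 ∧ 0 ≤ c.2 ∧ c.2 ≤ 3 ∧ c ≠ (3, 2) := by decide
  have bE : ∀ c ∈ underBlockE42, 1 ≤ c.1 ∧ c.1 ≤ 5 ∧ 0 ≤ c.2 ∧ c.2 ≤ 3 ∧ c ≠ (3, 2) := by decide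
  constructor
  · intro c hc
    simp only [underBlockW, List.mem_map] at hc
    obtain ⟨a, ha, rfl⟩ := hc
    obtain ⟨b1, b2, b3, b4, b5⟩ := bW a ha
    obtain ⟨x, y⟩ := a
    simp only [ne_eq, Prod.mk.injEq, not_and] at b1 b2 b3 b4 b5
    rw [shiftBy_refShift_mk, mem_boxMinus]
    simp only [List.mem_cons, List.not_mem_nil, or_false, not_or]
    refine ⟨⟨by omega, by omega, by omega, by omega⟩, fun e => ?_, fun e => ?_⟩
    · have e' := Prod.ext_iff.1 e; simp only at e'; omega
    · have e' := Prod.ext_iff.1 e; simp only at e'; omega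
  · intro c hc
    simp only [underBlockE, List.mem_map] at hc
    obtain ⟨a, ha, rfl⟩ := hc
    obtain ⟨b1, b2, b3, b4, b5⟩ := bE a ha
    obtain ⟨x, y⟩ := a
    simp only [ne_eq, Prod.mk.injEq, not_and] at b1 b2 b3 b4 b5
    rw [shiftBy_refShift_mk, mem_boxMinus]
    simp only [List.mem_cons, List.not_mem_nil, or_false, not_or]
    refine ⟨⟨by omega, by omega, by omega, by omega⟩, fun e => ?_, fun e => ?_⟩
    · have e' := Prod.ext_iff.1 e; simp only at e'; omega
    · have e' := Prod.ext_iff.1 e; simp only at e'; omega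

/-- ★★★★★ **THE TOP-WALL MIRROR: removing `(h.1, n − 1)` directly above the hole (hole two rows below the top wall) ⇒
`Im VF(θ) < 0` ON THE WHOLE RANGE** (over route empty). [cite: GlazmanManolescu2019, Lemma 2.1 (statement, "in the form given in [Gl]"), §2.1]
[cite: Glazman2015WeightedSAW, Lemma 3.1 (proof, pp. 6–7)] -/
theorem lawL_box_holeNN_im_neg (hW : 2 ≤ h.1) (hE : h.1 + 3 ≤ m) (hS : 2 ≤ h.2) (hN : h.2 + 3 = n) {θ : ℝ}
    (hθ : θ ∈ Set.Icc (π / 3) (2 * π / 3)) :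
    (vertexFunctional (printedWeights θ) tFiveEighths (ybCoeff θ) (boxMinus m n [h, (h.1, h.2 + 2)])
      (Face.side (h.1 + 1, h.2) .W) (farW (h.1 + 1, h.2))).im < 0 := by
  obtain ⟨hBW, hBE⟩ := underBlocks_hroot_subset_boxMinus_holeNN hW hE hS hN
  refine im_vertexFunctional_printed_neg_of_holeColumnN hθ hBW hBE ?_ ?_ fun y hy => ?_
  · rw [mem_boxMinus]; simp only [farW, List.mem_cons, List.not_mem_nil, or_false, not_or]
    refine ⟨⟨by omega, by omega, by omega, by omega⟩, fun e => ?_, fun e => ?_⟩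
    · have e' := Prod.ext_iff.1 e; simp only at e'; omega
    · have e' := Prod.ext_iff.1 e; simp only at e'; omega
  · rw [holeFaceW_hroot]; exact not_mem_dom_boxMinus_of_mem (by simp)
  · intro hm
    have hb := mem_dom_boxMinus.1 hm
    simp only [List.mem_cons, List.not_mem_nil, or_false, not_or, Prod.mk.injEq] at hb hy
    omega

end Boxes

end Literature.Barriers.CriticalPhenomena.PlaquetteWalk
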